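import Literature.NumberTheory.EllipticCurves.CubicResolventArtinFormalismBSDQuotient
import Summits.BirchSwinnertonDyer.Rank1Residual.AdditivePotMult.ModelFree
import Literature.NumberTheory.CubicFields.CubicResolventClosure
import Literature.NumberTheory.QuadraticFields.HeegnerCondition
import Literature.NumberTheory.EllipticCurves.QuadraticTwistIrreducibleModPFieldProofs
import Literature.NumberTheory.EllipticCurves.LFunctionSmulProofs
import Mathlib.FieldTheory.Galois.Basic
import HarnessLib

/-!
# Route `ByReductionTypeAtTwo` (rung K4), crux `AdditiveRankZeroAtTwo` (item
# stmt-BirchSwinnertonDyer-19098): the CUBIC-RESOLVENT DESCENT, part 1 — models and the ANALYTIC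
# side `ℓ(E_F)²·ℓ(E^{(D)})² = ℓ(E^{(D)}_F)²·ℓ(E)²`

HONEST FRAMING (cell `bsd-2adic`, run/shared/lean/pub/bsd-2adic/, HUMAN RULINGS D-0036/D-0074;
seat `bsd-2adic-addL2x` GEN 3, WIDTH-LEVER lane B «semistable base change to the field of good
reduction + Kato over that field + norm descent»): theorems only; NO new definition, NO new named
fact in this file (the PRINT inputs are consumed BY NAME: modularity `hmod`, Milne 1972 `hMilneC`,
Dokchitser–Dokchitser 2010 Thm. 2.3 `hDD`, Artin formalism `hArtin`, base change for `GL(2)`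
`hBC3`/`hBC6` — the last four from `Literature/…/CubicResolventArtinFormalismBSDQuotient.lean`,
p544626); nothing asserted; no class closed; nothing booked; BSD is not proved by any of this.
PARTITION (D-0054): X5@2 ADDITIVE, defect-`≥ 3` sub-class (B1·O1; 1 382 classes; the odd core `C₃`
454 is where the reading «good reduction over `F`» applies) × p = 2 — types-the-object-of; closes
none. bears_on: K4 (crux `AdditiveRankZeroAtTwo`, item stmt-BirchSwinnertonDyer-19098).

THE ROAD AND WHAT THIS REPAIRS. GEN 0 of this seat (VERDICT-19098-addL2x-GEN0 §2 (L3a), repair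
census R-B1/R-B2) found the norm-descent step of the director's road «circular»: over a cubic field
`F` with `2 = 𝔓³` an additive-at-`2` curve `E/ℚ` with semistability defect `Φ = C₃` acquires GOOD
(supersingular) reduction at `𝔓`, but `Res_{F/ℚ} E_F ∼ E × B` with the abelian surface
`B = E ⊗ ρ` (`ρ` the `2`-dimensional representation of `Gal(L/ℚ) ≅ S₃`, `L = F·K` the normal
closure, `K = ℚ(√d_F)` the quadratic resolvent — `2` INERT in `K`) again additive at `2`. THE
REPAIR: `B` is the same for `E` and for its RESOLVENT TWIST `E^{(d_K)}` (`Ind_{C₂}^{S₃} sgn =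
sgn ⊕ ρ`), so in the `S₃` Brauer relation `Ind_L 𝟙 ⊕ 𝟙² ≅ Ind_K 𝟙 ⊕ (Ind_F 𝟙)²`
(Dokchitser–Dokchitser 2010 §2.4) written for `E` and for `E^{(d_K)}`, everything over `L` and `K`
is common (`E^{(d_K)}_L ≅ E_L`, `E^{(d_K)}_K ≅ E_K`) and CANCELS. This file proves the analytic
half: from Artin formalism on `Re s > 3/2` (`LSeries_brauerS3`), the entire continuations
(`hasEntireLFunction_baseChange_cubic`, `…_of_isGalois_six`, the tree's quadratic case and
modularity), the identity theorem and the finiteness of `ord_{s=1} L(E_K, s)`: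
`ℓ(E_F)² · ℓ(E^{(d_K)})² = ℓ(E^{(d_K)}_F)² · ℓ(E)²` for the leading Taylor coefficients at `s = 1`
(`leadingLCoeff_sq_mul_sq_eq`). Part 2 (`…CubicResolventIdentity.lean`) adds the algebraic half
(Dokchitser–Dokchitser Thm. 2.3 twice) and the MAIN IDENTITY; part 3 (`…CubicResolventDescent.lean`)
the doors: per class `BSD₂(E) ⟺ δ₂(E_F) = δ₂(E^{(D)}_F) ⟸` the `2`-parts of BSD for `E` and
`E^{(D)}` over ONE cubic field of good reduction above `2`.

## Contents
* §1 `exists_variableChange_baseChange_eq_of_sq_eq` — over a number field containing `√d`, a model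
  of `E` is a model of `E^{(d)}` (Silverman *AEC* X.5.4; the tree's twist-by-squares lemmas).
* §2 `leadCoeff_congr`, `leadCoeff_mul_four` — leading Taylor data at `1`: germ invariance and
  fourfold products (the tree's `AdditivePotMult.leadCoeff_mul`).
* §3 `exists_sq_eq_discr_ne_zero`, `exists_variableChange_twist_baseChange_quadratic/_ext`,
  `leadingLCoeff_sq_mul_sq_eq` — the analytic identity.

References: [DokchitserDokchitserAnnals2010] §2.1, §2.4 (S₃ example), Thm. 2.3;
[JPSS1981Cubique]; [Langlands1980AMS96]; [SilvermanAEC2009] X.5 Cor. 5.4.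
-/

set_option autoImplicit false
-- the Theorems namespace of this sub repeats the summit name by design (D-0017 nested layout)
set_option linter.dupNamespace false

noncomputable section

open scoped Classical

open WeierstrassCurve Literature.NumberTheory.EllipticCurves
  Literature.NumberTheory.EllipticCurves.Rank1Residual
  Literature.NumberTheory.EllipticCurves.Rank1Residual.Typed
  Summit.BirchSwinnertonDyer.Rank1Residual.AdditivePotMult

namespace Summit.BirchSwinnertonDyer.BirchSwinnertonDyer.Theorems.CubicResolvent

/-! ## §1 Models: over a field containing `√d_K` the twist `E^{(d_K)}` and `E` have a common model -/

section Models

variable (W : WeierstrassCurve ℚ) (Wd : WeierstrassCurve ℚ) (d : ℚ)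
  (M : Type) [Field M] [NumberField M]

/-- If `C • W^{(d)} = Wd` over `ℚ` and `d = δ²` in a number field `M`, then `Wd_M ≅ W_M`: some
change of variables over `M` carries `Wd.baseChange M` to `W.baseChange M` (base change of the
`ℚ`-isomorphism, then `W_M^{(δ²)} ≅ W_M^{(1)} ≅ W_M`, Silverman *AEC* X.5.4). [folklore] -/
theorem exists_variableChange_baseChange_eq_of_sq_eq
    (hWd : ∃ C : VariableChange ℚ, C • W.quadraticTwist d = Wd) {δ : M}
    (hδ : δ ^ 2 = algebraMap ℚ M d) (hδ0 : δ ≠ 0) :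
    ∃ C : VariableChange M, C • Wd.baseChange M = W.baseChange M := by
  haveI : NeZero (2 : M) := ⟨two_ne_zero⟩
  obtain ⟨C₀, hC₀⟩ := hWd
  -- `C₀⁻¹ • Wd = W^{(d)}` over `ℚ`, base-changed to `M`
  have hC₀' : C₀⁻¹ • Wd = W.quadraticTwist d := by rw [← hC₀, inv_smul_smul]
  have h1 : (C₀⁻¹.map (algebraMap ℚ M)) • Wd.baseChange M =
      (W.baseChange M).quadraticTwist (algebraMap ℚ M d) :=
    map_smul_baseChange_eq_quadraticTwist_baseChange hC₀' M
  -- `W_M^{(δ²)} = C₂ • W_M^{(1)}` and `W_M^{(1)} = C₃ • W_M`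
  obtain ⟨C₂, hC₂⟩ := (W.baseChange M).exists_variableChange_quadraticTwist_mul_sq 1 δ hδ0
  obtain ⟨C₃, hC₃⟩ := (W.baseChange M).exists_variableChange_quadraticTwist_one
  have h2 : (W.baseChange M).quadraticTwist (algebraMap ℚ M d) = (C₂ * C₃) • W.baseChange M := by
    rw [mul_smul, hC₃, hC₂, ← hδ, one_mul]
  refine ⟨(C₂ * C₃)⁻¹ * C₀⁻¹.map (algebraMap ℚ M), ?_⟩
  rw [mul_smul, h1, h2, inv_smul_smul]

end Models

/-! ## §2 Leading Taylor coefficients at `s = 1`: germ invariance and fourfold products -/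

section Analytic

open Filter Topology

/-- The leading Taylor datum `f^{(n)}(1)/n!`, `n = ord_{s=1} f`, depends only on the germ of `f` at
`1`. [folklore] -/
theorem leadCoeff_congr {φ ψ : ℂ → ℂ} (h : φ =ᶠ[𝓝 (1 : ℂ)] ψ) :
    iteratedDeriv (analyticOrderNatAt φ 1) φ 1 / ((analyticOrderNatAt φ 1).factorial : ℂ) =
      iteratedDeriv (analyticOrderNatAt ψ 1) ψ 1 / ((analyticOrderNatAt ψ 1).factorial : ℂ) := by
  have hord : analyticOrderNatAt φ 1 = analyticOrderNatAt ψ 1 := by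
    unfold analyticOrderNatAt
    rw [analyticOrderAt_congr h]
  rw [hord, Filter.EventuallyEq.iteratedDeriv_eq _ h]

/-- Leading Taylor data of a fourfold product of functions analytic at `1` and not identically
zero there multiply (the tree's `leadCoeff_mul`, three times). [folklore] -/
theorem leadCoeff_mul_four {a b c e : ℂ → ℂ} (ha : AnalyticAt ℂ a 1) (hb : AnalyticAt ℂ b 1)
    (hc : AnalyticAt ℂ c 1) (he : AnalyticAt ℂ e 1) (ha' : analyticOrderAt a 1 ≠ ⊤)
    (hb' : analyticOrderAt b 1 ≠ ⊤) (hc' : analyticOrderAt c 1 ≠ ⊤)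
    (he' : analyticOrderAt e 1 ≠ ⊤) :
    iteratedDeriv (analyticOrderNatAt (a * b * c * e) 1) (a * b * c * e) 1 /
        ((analyticOrderNatAt (a * b * c * e) 1).factorial : ℂ) =
      (iteratedDeriv (analyticOrderNatAt a 1) a 1 / ((analyticOrderNatAt a 1).factorial : ℂ)) *
      (iteratedDeriv (analyticOrderNatAt b 1) b 1 / ((analyticOrderNatAt b 1).factorial : ℂ)) *
      (iteratedDeriv (analyticOrderNatAt c 1) c 1 / ((analyticOrderNatAt c 1).factorial : ℂ)) *
      (iteratedDeriv (analyticOrderNatAt e 1) e 1 / ((analyticOrderNatAt e 1).factorial : ℂ)) := by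
  have hab : AnalyticAt ℂ (a * b) 1 := ha.mul hb
  have hab' : analyticOrderAt (a * b) 1 ≠ ⊤ := by
    rw [analyticOrderAt_mul ha hb]; exact WithTop.add_ne_top.mpr ⟨ha', hb'⟩
  have habc : AnalyticAt ℂ (a * b * c) 1 := hab.mul hc
  have habc' : analyticOrderAt (a * b * c) 1 ≠ ⊤ := by
    rw [analyticOrderAt_mul hab hc]; exact WithTop.add_ne_top.mpr ⟨hab', hc'⟩
  rw [leadCoeff_mul habc he habc' he', leadCoeff_mul hab hc hab' hc', leadCoeff_mul ha hb ha' hb']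

end Analytic

/-! ## §3 The `S₃` configuration: the analytic identity `ℓ(E_F)²·ℓ(E')² = ℓ(E'_F)²·ℓ(E)²` -/

section Configuration

open Filter Topology Literature.NumberTheory.QuadraticFields

variable (W : WeierstrassCurve ℚ) [W.IsElliptic] (Wd : WeierstrassCurve ℚ) [Wd.IsElliptic]
  (K : Type) [Field K] [NumberField K] (F : Type) [Field F] [NumberField F]
  (L : Type) [Field L] [NumberField L] [Algebra F L] [Algebra K L]
  (VF : WeierstrassCurve F) [VF.IsElliptic] (VF' : WeierstrassCurve F) [VF'.IsElliptic]

/-- A square root of `d_K` in the quadratic field `K` (Marcus Ch. 2; the tree's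
`Quadratic.exists_sq_eq_discr`), as an element of `K` with `δ² = d_K`, `δ ≠ 0`. [folklore] -/
theorem exists_sq_eq_discr_ne_zero (hK2 : Module.finrank ℚ K = 2) :
    ∃ δ : K, δ ^ 2 = algebraMap ℚ K (NumberField.discr K : ℚ) ∧ δ ≠ 0 := by
  obtain ⟨-, -, δ, -, hδ⟩ := Quadratic.exists_sq_eq_discr (K := K) hK2
  refine ⟨algebraMap (NumberField.RingOfIntegers K) K δ, ?_, ?_⟩
  · rw [← map_pow, hδ, map_intCast, map_intCast]
  · intro h0
    have h0' : δ = 0 := (map_eq_zero_iff _ (NumberField.RingOfIntegers.coe_injective)).mp h0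
    have : (NumberField.discr K : NumberField.RingOfIntegers K) = 0 := by
      rw [← hδ, h0', zero_pow two_ne_zero]
    exact NumberField.discr_ne_zero K (by exact_mod_cast this)

omit [W.IsElliptic] [Wd.IsElliptic] in
/-- Over `K` itself `E^{(d_K)}_K ≅ E_K`: the canonical model `W.baseChange K` is a model of
`Wd.baseChange K`. [folklore] -/
theorem exists_variableChange_twist_baseChange_quadratic (hK2 : Module.finrank ℚ K = 2)
    (hWd : ∃ C : VariableChange ℚ, C • W.quadraticTwist (NumberField.discr K : ℚ) = Wd) :
    ∃ C : VariableChange K, C • Wd.baseChange K = W.baseChange K := by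
  obtain ⟨δ, hδ, hδ0⟩ := exists_sq_eq_discr_ne_zero K hK2
  exact exists_variableChange_baseChange_eq_of_sq_eq W Wd _ K hWd hδ hδ0

omit [W.IsElliptic] [Wd.IsElliptic] [Algebra F L] in
/-- Over any field `L ⊇ K`, `E^{(d_K)}_L ≅ E_L` likewise. [folklore] -/
theorem exists_variableChange_twist_baseChange_ext (hK2 : Module.finrank ℚ K = 2)
    (hWd : ∃ C : VariableChange ℚ, C • W.quadraticTwist (NumberField.discr K : ℚ) = Wd) :
    ∃ C : VariableChange L, C • Wd.baseChange L = W.baseChange L := by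
  obtain ⟨δ, hδ, hδ0⟩ := exists_sq_eq_discr_ne_zero K hK2
  refine exists_variableChange_baseChange_eq_of_sq_eq W Wd _ L hWd (δ := algebraMap K L δ) ?_
    ((map_ne_zero _).mpr hδ0)
  rw [← map_pow, hδ]
  simp only [map_intCast]

/-- **Analytic side.** In the `S₃` configuration (`K` quadratic, `F` cubic with `d_F = d_K f²`,
`L ⊇ F, K` Galois of degree `6`), for `Wd` a model of `W^{(d_K)}` and models `VF`, `VF'` of `W_F`,
`Wd_F`: `ℓ(VF)²·ℓ(Wd)² = ℓ(VF')²·ℓ(W)²` for the leading Taylor coefficients at `s = 1`. Proof: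
Artin formalism for the `S₃` relation (`LSeries_brauerS3`) for `W` and for `Wd` on `Re s > 3/2`,
with `Wd_L ≅ W_L`, `Wd_K ≅ W_K`; continuation to `ℂ` of the six `L`-functions (modularity over `ℚ`,
`hasEntireLFunction_baseChange_cubic`, `…_of_isGalois_six`, the tree's quadratic case); the identity
theorem; cancellation of `L(E_K,s)` at the level of germs at `1` (its order there is finite); and
multiplicativity of leading Taylor coefficients. The abelian surface `E ⊗ ρ` never appears. [folklore] -/
theorem leadingLCoeff_sq_mul_sq_eq (hmod : hasEntireLFunction_rat) (hArtin : LSeries_brauerS3)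
    (hBC3 : hasEntireLFunction_baseChange_cubic)
    (hBC6 : hasEntireLFunction_baseChange_of_isGalois_six)
    (hK2 : Module.finrank ℚ K = 2) (hF3 : Module.finrank ℚ F = 3) {f : ℤ} (hf : f ≠ 0)
    (hdisc : NumberField.discr F = NumberField.discr K * f ^ 2)
    (hL6 : Module.finrank ℚ L = 6) (hGal : IsGalois ℚ L)
    (hWd : ∃ C : VariableChange ℚ, C • W.quadraticTwist (NumberField.discr K : ℚ) = Wd)
    (hVF : ∃ C : VariableChange F, C • W.baseChange F = VF)
    (hVF' : ∃ C : VariableChange F, C • Wd.baseChange F = VF') :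
    VF.leadingLCoeff ^ 2 * Wd.leadingLCoeff ^ 2 = VF'.leadingLCoeff ^ 2 * W.leadingLCoeff ^ 2 := by
  -- models
  obtain ⟨CF, rfl⟩ := hVF
  obtain ⟨CF', rfl⟩ := hVF'
  rw [leadingLCoeff_smul, leadingLCoeff_smul]
  haveI : (W.baseChange F).IsElliptic := by rw [baseChange]; infer_instance
  haveI : (Wd.baseChange F).IsElliptic := by rw [baseChange]; infer_instance
  haveI : (W.baseChange K).IsElliptic := by rw [baseChange]; infer_instance
  haveI : (W.baseChange L).IsElliptic := by rw [baseChange]; infer_instance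
  haveI : (Wd.baseChange K).IsElliptic := by rw [baseChange]; infer_instance
  haveI : (Wd.baseChange L).IsElliptic := by rw [baseChange]; infer_instance
  obtain ⟨CK, hCK⟩ := exists_variableChange_twist_baseChange_quadratic W Wd K hK2 hWd
  obtain ⟨CL, hCL⟩ := exists_variableChange_twist_baseChange_ext W Wd K L hK2 hWd
  -- the six entire functions
  have hD : (NumberField.discr K : ℚ) ≠ 0 := by exact_mod_cast NumberField.discr_ne_zero K
  haveI : (W.quadraticTwist (NumberField.discr K : ℚ)).IsElliptic := W.isElliptic_quadraticTwist hD
  have hW : W.HasEntireLFunction := hmod W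
  have hWd' : Wd.HasEntireLFunction := hmod Wd
  have hF : (W.baseChange F).HasEntireLFunction := hBC3 W F hF3
  have hF' : (Wd.baseChange F).HasEntireLFunction := hBC3 Wd F hF3
  have hLL : (W.baseChange L).HasEntireLFunction := hBC6 W L hL6 hGal
  have hKK : (W.baseChange K).HasEntireLFunction :=
    (hasEntireLFunction_baseChange_quadratic LSeries_baseChange_quadratic_holds W K hK2 hW
      (hmod _)).1
  set eW := W.entireLFunction with heW
  set eWd := Wd.entireLFunction with heWd
  set eF := (W.baseChange F).entireLFunction with heF
  set eF' := (Wd.baseChange F).entireLFunction with heF'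
  set eK := (W.baseChange K).entireLFunction with heK
  set eL := (W.baseChange L).entireLFunction with heL
  have dW := W.differentiable_entireLFunction hW
  have dWd := Wd.differentiable_entireLFunction hWd'
  have dF := (W.baseChange F).differentiable_entireLFunction hF
  have dF' := (Wd.baseChange F).differentiable_entireLFunction hF'
  have dK := (W.baseChange K).differentiable_entireLFunction hKK
  have dL := (W.baseChange L).differentiable_entireLFunction hLL
  -- `L`-series of `Wd` over `K` and `L` are those of `W`
  have hLK : (Wd.baseChange K).LSeries = (W.baseChange K).LSeries := by
    rw [← hCK, WeierstrassCurve.LSeries_smul]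
  have hLL' : (Wd.baseChange L).LSeries = (W.baseChange L).LSeries := by
    rw [← hCL, WeierstrassCurve.LSeries_smul]
  -- Artin formalism, continued to all of `ℂ` (identity theorem)
  have hopen : IsOpen {s : ℂ | (3 / 2 : ℝ) < s.re} := isOpen_lt continuous_const Complex.continuous_re
  have h2mem : {s : ℂ | (3 / 2 : ℝ) < s.re} ∈ 𝓝 (2 : ℂ) :=
    hopen.mem_nhds (show (3 / 2 : ℝ) < (2 : ℂ).re by norm_num)
  have hA1 : (fun s => eL s * eW s ^ 2) = fun s => eK s * eF s ^ 2 := by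
    refine AnalyticOnNhd.eq_of_eventuallyEq (z₀ := (2 : ℂ))
      ((dL.mul (dW.pow 2)).differentiableOn.analyticOnNhd isOpen_univ)
      ((dK.mul (dF.pow 2)).differentiableOn.analyticOnNhd isOpen_univ) ?_
    filter_upwards [h2mem] with s hs
    simp only [eL, eW, eK, eF]
    rw [(W.baseChange L).entireLFunction_eq_LSeries hLL hs, W.entireLFunction_eq_LSeries hW hs,
      (W.baseChange K).entireLFunction_eq_LSeries hKK hs,
      (W.baseChange F).entireLFunction_eq_LSeries hF hs]
    exact hArtin W K hK2 F hF3 f hf hdisc L hL6 hGal s hs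
  have hA2 : (fun s => eL s * eWd s ^ 2) = fun s => eK s * eF' s ^ 2 := by
    refine AnalyticOnNhd.eq_of_eventuallyEq (z₀ := (2 : ℂ))
      ((dL.mul (dWd.pow 2)).differentiableOn.analyticOnNhd isOpen_univ)
      ((dK.mul (dF'.pow 2)).differentiableOn.analyticOnNhd isOpen_univ) ?_
    filter_upwards [h2mem] with s hs
    simp only [eL, eWd, eK, eF']
    rw [(W.baseChange L).entireLFunction_eq_LSeries hLL hs, Wd.entireLFunction_eq_LSeries hWd' hs,
      (W.baseChange K).entireLFunction_eq_LSeries hKK hs,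
      (Wd.baseChange F).entireLFunction_eq_LSeries hF' hs, ← hLK, ← hLL']
    exact hArtin Wd K hK2 F hF3 f hf hdisc L hL6 hGal s hs
  -- cancel `L(E_K, s)` at the level of germs at `s = 1`
  set H : ℂ → ℂ := fun s => eF s ^ 2 * eWd s ^ 2 - eF' s ^ 2 * eW s ^ 2 with hH
  have hKH : eK * H = 0 := by
    funext s
    have h1 : eL s * eW s ^ 2 = eK s * eF s ^ 2 := congrFun hA1 s
    have h2 : eL s * eWd s ^ 2 = eK s * eF' s ^ 2 := congrFun hA2 s
    show eK s * (eF s ^ 2 * eWd s ^ 2 - eF' s ^ 2 * eW s ^ 2) = 0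
    linear_combination eW s ^ 2 * h2 - eWd s ^ 2 * h1
  have haK : AnalyticAt ℂ eK 1 := dK.analyticAt 1
  have dH : Differentiable ℂ H :=
    ((dF.pow 2).mul (dWd.pow 2)).sub ((dF'.pow 2).mul (dW.pow 2))
  have haH : AnalyticAt ℂ H 1 := dH.analyticAt 1
  have htop : analyticOrderAt (eK * H) 1 = ⊤ := by
    rw [hKH]; exact analyticOrderAt_eq_top.mpr (Filter.Eventually.of_forall fun _ => rfl)
  rw [analyticOrderAt_mul haK haH] at htop
  have hKtop : analyticOrderAt eK 1 ≠ ⊤ :=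
    (W.baseChange K).analyticOrderAt_entireLFunction_ne_top hKK
  have hHtop : analyticOrderAt H 1 = ⊤ := by
    rcases WithTop.add_eq_top.mp htop with h | h
    · exact absurd h hKtop
    · exact h
  have hgerm : (eF * eF * eWd * eWd) =ᶠ[𝓝 (1 : ℂ)] (eF' * eF' * eW * eW) := by
    have h0 := analyticOrderAt_eq_top.mp hHtop
    filter_upwards [h0] with s hs
    simp only [H, sub_eq_zero] at hs
    simp only [Pi.mul_apply]
    linear_combination hs
  -- leading Taylor coefficients
  have oW := W.analyticOrderAt_entireLFunction_ne_top hW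
  have oWd := Wd.analyticOrderAt_entireLFunction_ne_top hWd'
  have oF := (W.baseChange F).analyticOrderAt_entireLFunction_ne_top hF
  have oF' := (Wd.baseChange F).analyticOrderAt_entireLFunction_ne_top hF'
  have key := leadCoeff_congr hgerm
  rw [leadCoeff_mul_four (dF.analyticAt 1) (dF.analyticAt 1) (dWd.analyticAt 1) (dWd.analyticAt 1)
      oF oF oWd oWd,
    leadCoeff_mul_four (dF'.analyticAt 1) (dF'.analyticAt 1) (dW.analyticAt 1) (dW.analyticAt 1)
      oF' oF' oW oW] at key
  unfold WeierstrassCurve.leadingLCoeff WeierstrassCurve.analyticRank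
  simp only [← heW, ← heWd, ← heF, ← heF']
  linear_combination key

end Configuration

end Summit.BirchSwinnertonDyer.BirchSwinnertonDyer.Theorems.CubicResolvent

end
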